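import Summits.Parity.BatemanHorn.Theorems.SoloInformedHooleyShiftWeights

/-!
# First and second differences of `g(m)`: eventual monotonicity of `|g(m)|` and `∇²g ≪ m^{d−2}`

Informed soloist `solo-Parity-informed` (session 143), conjunct `BatemanHorn`, the `d ≥ 3` rung BELOW the parity
wall; first input file for the second-order Abel summation in `m` of the trapezoid kernels
(`SoloInformedTrapezoidForm`, `SoloInformedAbelKernel`).  Elementary facts about an integer polynomial `g` of
degree `d ≥ 1` along `ℕ`:

* `exists_natAbs_eval_lt_succ`: `|g(m)| < |g(m+1)|` for all `m ≥ m₀` (leading increment `≥ d·m^{d−1}` against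
  lower-order increments `≤ (d−1)‖g‖₁(m+1)^{d−2}`), hence `m ↦ |g(m)|` and every located weight `m ↦ a_e(m)` is
  nondecreasing from `m₀` on, uniformly in the modulus `e` (`natAbs_eval_mono`, `locWeight_mono_of_le`);
* `pow_second_diff_le`: `0 ≤ (m+2)^i − 2(m+1)^i + m^i ≤ i(i−1)(m+2)^{i−2}`, whence
  `abs_eval_second_diff_le`: `|g(m+2) − 2g(m+1) + g(m)| ≤ d(d−1)‖g‖₁(m+2)^{d−2}`.
-/

namespace Summit.Parity.BatemanHorn.Theorems

open Finset Polynomial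

/-! ### Eventual strict monotonicity of `|g(m)|` -/

/-- `d·m^{d−1} ≤ (m+1)^d − m^d`. [folklore] -/
theorem mul_pow_le_pow_succ_sub_pow (m d : ℕ) :
    (d : ℝ) * (m : ℝ) ^ (d - 1) ≤ ((m : ℝ) + 1) ^ d - (m : ℝ) ^ d := by
  have h := geom_sum₂_mul ((m : ℝ) + 1) (m : ℝ) d
  rw [show ((m : ℝ) + 1 - m) = 1 by ring, mul_one] at h
  rw [← h]
  calc (d : ℝ) * (m : ℝ) ^ (d - 1) = ∑ _j ∈ range d, (m : ℝ) ^ (d - 1) := by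
        rw [sum_const, card_range, nsmul_eq_mul]
    _ ≤ ∑ j ∈ range d, ((m : ℝ) + 1) ^ j * (m : ℝ) ^ (d - 1 - j) := by
        refine sum_le_sum fun j hj => ?_
        rw [mem_range] at hj
        calc (m : ℝ) ^ (d - 1) = (m : ℝ) ^ j * (m : ℝ) ^ (d - 1 - j) := by
              rw [← pow_add]; congr 1; omega
          _ ≤ ((m : ℝ) + 1) ^ j * (m : ℝ) ^ (d - 1 - j) :=
              mul_le_mul_of_nonneg_right (pow_le_pow_left₀ (by positivity) (by linarith) _) (by positivity)

/-- The increment split off its leading term: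
`g(m+1) − g(m) = a_d((m+1)^d − m^d) + ∑_{i<d} a_i((m+1)^i − m^i)`. [folklore] -/
theorem eval_succ_sub_eval_eq (g : ℤ[X]) (m : ℕ) :
    ((g.eval ((m : ℤ) + 1) : ℤ) : ℝ) - ((g.eval (m : ℤ) : ℤ) : ℝ)
      = (g.leadingCoeff : ℝ) * (((m : ℝ) + 1) ^ g.natDegree - (m : ℝ) ^ g.natDegree)
        + ∑ i ∈ range g.natDegree, (g.coeff i : ℝ) * (((m : ℝ) + 1) ^ i - (m : ℝ) ^ i) := by
  rw [eval_eq_sum_range, eval_eq_sum_range]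
  push_cast
  rw [← sum_sub_distrib, sum_range_succ, add_comm, leadingCoeff]
  congr 1
  · ring
  · exact sum_congr rfl fun i _ => by ring

/-- The lower-order increments: `|∑_{i<d} a_i((m+1)^i − m^i)| ≤ (d−1)·‖g‖₁·(m+1)^{d−2}`. [folklore] -/
theorem abs_sum_lower_incr_le (g : ℤ[X]) (m : ℕ) :
    |∑ i ∈ range g.natDegree, (g.coeff i : ℝ) * (((m : ℝ) + 1) ^ i - (m : ℝ) ^ i)|
      ≤ ((g.natDegree - 1 : ℕ) : ℝ) * coeffAbsSum g * ((m : ℝ) + 1) ^ (g.natDegree - 2) := by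
  refine (abs_sum_le_sum_abs _ _).trans ?_
  have hterm : ∀ i ∈ range g.natDegree, |(g.coeff i : ℝ) * (((m : ℝ) + 1) ^ i - (m : ℝ) ^ i)|
      ≤ ((g.natDegree - 1 : ℕ) : ℝ) * ((m : ℝ) + 1) ^ (g.natDegree - 2) * |(g.coeff i : ℝ)| := by
    intro i hi
    rw [mem_range] at hi
    have hi1 : i ≤ g.natDegree - 1 := by omega
    have hi2 : i - 1 ≤ g.natDegree - 2 := by omega
    rw [abs_mul, abs_of_nonneg (pow_succ_sub_pow_nonneg m i), mul_comm]
    refine mul_le_mul_of_nonneg_right ((pow_succ_sub_pow_le m i).trans ?_) (abs_nonneg _)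
    exact mul_le_mul (by exact_mod_cast hi1)
      (pow_le_pow_right₀ (by linarith [(Nat.cast_nonneg m : (0 : ℝ) ≤ m)]) hi2) (by positivity)
      (Nat.cast_nonneg _)
  refine (sum_le_sum hterm).trans ?_
  rw [← mul_sum]
  have hsub : ∑ i ∈ range g.natDegree, |(g.coeff i : ℝ)| ≤ coeffAbsSum g := by
    unfold coeffAbsSum
    exact sum_le_sum_of_subset_of_nonneg (Finset.range_mono (Nat.le_succ g.natDegree)) fun _ _ _ => abs_nonneg _
  calc ((g.natDegree - 1 : ℕ) : ℝ) * ((m : ℝ) + 1) ^ (g.natDegree - 2) * ∑ i ∈ range g.natDegree, |(g.coeff i : ℝ)|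
      ≤ ((g.natDegree - 1 : ℕ) : ℝ) * ((m : ℝ) + 1) ^ (g.natDegree - 2) * coeffAbsSum g :=
        mul_le_mul_of_nonneg_left hsub (by positivity)
    _ = _ := by ring

/-- `0 ≤ ‖g‖₁`. [folklore] -/
theorem coeffAbsSum_nonneg (g : ℤ[X]) : 0 ≤ coeffAbsSum g :=
  sum_nonneg fun _ _ => abs_nonneg _

/-- **Eventual strict increase**: for `g ∈ ℤ[X]` of degree `d ≥ 1` with positive leading coefficient,
`g(m) < g(m+1)` for every `m ≥ m₀`. [folklore] -/
theorem exists_eval_lt_eval_succ {g : ℤ[X]} (hdeg : 0 < g.natDegree) (hlc : 0 < g.leadingCoeff) :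
    ∃ m₀ : ℕ, ∀ m : ℕ, m₀ ≤ m → g.eval (m : ℤ) < g.eval ((m : ℤ) + 1) := by
  set d := g.natDegree with hd
  set L := coeffAbsSum g with hL
  have hL0 : 0 ≤ L := coeffAbsSum_nonneg g
  refine ⟨⌈L * 2 ^ (d - 2)⌉₊ + 1, fun m hm => ?_⟩
  have hm1 : 1 ≤ m := by omega
  have hm0 : (1 : ℝ) ≤ m := by exact_mod_cast hm1
  have hmL : L * 2 ^ (d - 2) + 1 ≤ m := by
    have h1 := Nat.le_ceil (L * 2 ^ (d - 2))
    have h2 : ((⌈L * 2 ^ (d - 2)⌉₊ + 1 : ℕ) : ℝ) ≤ m := by exact_mod_cast hm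
    push_cast at h2
    linarith
  suffices h : (0 : ℝ) < ((g.eval ((m : ℤ) + 1) : ℤ) : ℝ) - ((g.eval (m : ℤ) : ℤ) : ℝ) by
    have : ((g.eval (m : ℤ) : ℤ) : ℝ) < ((g.eval ((m : ℤ) + 1) : ℤ) : ℝ) := by linarith
    exact_mod_cast this
  rw [eval_succ_sub_eval_eq]
  have hlc1 : (1 : ℝ) ≤ (g.leadingCoeff : ℝ) := by exact_mod_cast hlc
  have hlead : (d : ℝ) * (m : ℝ) ^ (d - 1)
      ≤ (g.leadingCoeff : ℝ) * (((m : ℝ) + 1) ^ d - (m : ℝ) ^ d) :=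
    (mul_pow_le_pow_succ_sub_pow m d).trans
      (le_mul_of_one_le_left (pow_succ_sub_pow_nonneg m d) hlc1)
  have hlow := (abs_le.mp (abs_sum_lower_incr_le g m)).1
  rw [← hd] at hlow
  -- `d m^{d-1} > (d-1) L (m+1)^{d-2}`
  have hkey : ((d - 1 : ℕ) : ℝ) * L * ((m : ℝ) + 1) ^ (d - 2) < (d : ℝ) * (m : ℝ) ^ (d - 1) := by
    rcases (by omega : d = 1 ∨ 2 ≤ d) with h1 | h2
    · rw [h1]; norm_num
    · have hd1 : ((d - 1 : ℕ) : ℝ) = (d : ℝ) - 1 := by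
        rw [Nat.cast_sub (by omega : 1 ≤ d)]; push_cast; ring
      have hpow2 : ((m : ℝ) + 1) ^ (d - 2) ≤ (2 : ℝ) ^ (d - 2) * (m : ℝ) ^ (d - 2) := by
        rw [← mul_pow]
        exact pow_le_pow_left₀ (by positivity) (by linarith) _
      have hmd : (m : ℝ) ^ (d - 1) = (m : ℝ) * (m : ℝ) ^ (d - 2) := by
        rw [show d - 1 = (d - 2) + 1 by omega, pow_succ, mul_comm]
      rw [hd1, hmd]
      have hmd2 : (0 : ℝ) < (m : ℝ) ^ (d - 2) := by positivity
      have hdpos : (1 : ℝ) ≤ d := by exact_mod_cast hdeg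
      -- `(d-1) L 2^{d-2} m^{d-2} < d m m^{d-2}`
      have h3 : ((d : ℝ) - 1) * L * (2 : ℝ) ^ (d - 2) < (d : ℝ) * m := by
        have h4 : ((d : ℝ) - 1) * (L * (2 : ℝ) ^ (d - 2)) ≤ (d : ℝ) * (L * (2 : ℝ) ^ (d - 2)) :=
          mul_le_mul_of_nonneg_right (by linarith) (by positivity)
        nlinarith
      calc ((d : ℝ) - 1) * L * ((m : ℝ) + 1) ^ (d - 2)
          ≤ ((d : ℝ) - 1) * L * ((2 : ℝ) ^ (d - 2) * (m : ℝ) ^ (d - 2)) :=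
            mul_le_mul_of_nonneg_left hpow2 (mul_nonneg (by linarith) hL0)
        _ = ((d : ℝ) - 1) * L * (2 : ℝ) ^ (d - 2) * (m : ℝ) ^ (d - 2) := by ring
        _ < (d : ℝ) * ((m : ℝ) * (m : ℝ) ^ (d - 2)) := by
            rw [← mul_assoc]; exact mul_lt_mul_of_pos_right h3 hmd2
  linarith

/-- **Eventual strict increase of `|g(m)|`** for any `g ∈ ℤ[X]` of degree `≥ 1`: `|g(m)| < |g(m+1)|` for all
`m ≥ m₀`. [folklore] -/
theorem exists_natAbs_eval_lt_succ {g : ℤ[X]} (hdeg : 0 < g.natDegree) :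
    ∃ m₀ : ℕ, ∀ m : ℕ, m₀ ≤ m → (g.eval (m : ℤ)).natAbs < (g.eval ((m : ℤ) + 1)).natAbs := by
  have hg : g ≠ 0 := fun h => by simp [h] at hdeg
  -- reduce to positive leading coefficient
  suffices key : ∀ f : ℤ[X], 0 < f.natDegree → 0 < f.leadingCoeff →
      ∃ m₀ : ℕ, ∀ m : ℕ, m₀ ≤ m → (f.eval (m : ℤ)).natAbs < (f.eval ((m : ℤ) + 1)).natAbs by
    rcases lt_or_gt_of_ne (leadingCoeff_ne_zero.mpr hg) with hneg | hpos
    · obtain ⟨m₀, hm₀⟩ := key (-g) (by rwa [natDegree_neg]) (by rw [leadingCoeff_neg]; omega)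
      refine ⟨m₀, fun m hm => ?_⟩
      have := hm₀ m hm
      rwa [eval_neg, eval_neg, Int.natAbs_neg, Int.natAbs_neg] at this
    · exact key g hdeg hpos
  intro f hfd hflc
  obtain ⟨m₀, hm₀⟩ := exists_eval_lt_eval_succ hfd hflc
  obtain ⟨m₁, hm₁⟩ := exists_eval_natCast_pos hfd hflc
  refine ⟨max m₀ m₁, fun m hm => ?_⟩
  exact Int.natAbs_lt_natAbs_of_nonneg_of_lt (hm₁ m ((le_max_right _ _).trans hm)).le
    (hm₀ m ((le_max_left _ _).trans hm))

/-- **Eventual monotonicity of `|g(m)|`**: with `m₀` as in `exists_natAbs_eval_lt_succ`, `|g(m)| ≤ |g(m')|` for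
`m₀ ≤ m ≤ m'`. [folklore] -/
theorem natAbs_eval_mono {g : ℤ[X]} {m₀ : ℕ}
    (h : ∀ m : ℕ, m₀ ≤ m → (g.eval (m : ℤ)).natAbs < (g.eval ((m : ℤ) + 1)).natAbs)
    {m m' : ℕ} (hm : m₀ ≤ m) (hmm' : m ≤ m') :
    (g.eval (m : ℤ)).natAbs ≤ (g.eval (m' : ℤ)).natAbs := by
  have hmono : Monotone fun k : ℕ => (g.eval ((m₀ + k : ℕ) : ℤ)).natAbs := by
    refine monotone_nat_of_le_succ fun k => ?_
    have := h (m₀ + k) (by omega)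
    push_cast at this ⊢
    rw [show ((m₀ : ℤ) + ((k : ℤ) + 1)) = (m₀ : ℤ) + k + 1 by ring]
    exact this.le
  have := hmono (show m - m₀ ≤ m' - m₀ by omega)
  simp only at this
  rwa [show m₀ + (m - m₀) = m by omega, show m₀ + (m' - m₀) = m' by omega] at this

/-- **The located weights are eventually nondecreasing in `m`**, uniformly in the modulus: with `m₀` as in
`exists_natAbs_eval_lt_succ` (and `g(m) ≠ 0`), `a_e(m) ≤ a_e(m')` for `m₀ ≤ m ≤ m'`, every `e`, `Δ > 0`. [this work] -/
theorem locWeight_mono_of_le (g : ℤ[X]) {Δ : ℝ} (hΔ : 0 < Δ) {m₀ : ℕ}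
    (h : ∀ m : ℕ, m₀ ≤ m → (g.eval (m : ℤ)).natAbs < (g.eval ((m : ℤ) + 1)).natAbs)
    (e : ℕ) {m m' : ℕ} (hm0 : g.eval (m : ℤ) ≠ 0) (hm : m₀ ≤ m) (hmm' : m ≤ m') :
    locWeight g Δ e m ≤ locWeight g Δ e m' :=
  locWeight_mono g hΔ e hm0 (natAbs_eval_mono h hm hmm')

/-! ### Second differences: `∇²g ≪ m^{d−2}` and `∇² log|g| ≪ 1/m²` -/

/-- `0 ≤ (m+2)^i − m^i ≤ 2i(m+2)^{i−1}`. [folklore] -/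
theorem pow_add_two_sub_pow_le (m i : ℕ) :
    0 ≤ ((m : ℝ) + 2) ^ i - (m : ℝ) ^ i ∧ ((m : ℝ) + 2) ^ i - (m : ℝ) ^ i ≤ 2 * i * ((m : ℝ) + 2) ^ (i - 1) := by
  have h1 := pow_succ_sub_pow_le (m + 1) i
  have h2 := pow_succ_sub_pow_le m i
  have h3 := pow_succ_sub_pow_nonneg (m + 1) i
  have h4 := pow_succ_sub_pow_nonneg m i
  push_cast at h1 h3
  rw [show (m : ℝ) + 1 + 1 = (m : ℝ) + 2 by ring] at h1 h3
  have h5 : (i : ℝ) * ((m : ℝ) + 1) ^ (i - 1) ≤ i * ((m : ℝ) + 2) ^ (i - 1) :=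
    mul_le_mul_of_nonneg_left (pow_le_pow_left₀ (by positivity) (by linarith) _) (Nat.cast_nonneg _)
  constructor <;> linarith

/-- **Second differences of powers**: `0 ≤ (m+2)^i − 2(m+1)^i + m^i ≤ i(i−1)(m+2)^{i−2}`. [folklore] -/
theorem pow_second_diff_le (m i : ℕ) :
    0 ≤ ((m : ℝ) + 2) ^ i - 2 * ((m : ℝ) + 1) ^ i + (m : ℝ) ^ i
      ∧ ((m : ℝ) + 2) ^ i - 2 * ((m : ℝ) + 1) ^ i + (m : ℝ) ^ i
        ≤ (i : ℝ) * ((i - 1 : ℕ) : ℝ) * ((m : ℝ) + 2) ^ (i - 2) := by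
  induction i with
  | zero => norm_num
  | succ i ih =>
    -- `s_{i+1} = (m+1) s_i + ((m+2)^i − m^i)`
    have hrec : ((m : ℝ) + 2) ^ (i + 1) - 2 * ((m : ℝ) + 1) ^ (i + 1) + (m : ℝ) ^ (i + 1)
        = ((m : ℝ) + 1) * (((m : ℝ) + 2) ^ i - 2 * ((m : ℝ) + 1) ^ i + (m : ℝ) ^ i)
          + (((m : ℝ) + 2) ^ i - (m : ℝ) ^ i) := by ring
    rw [hrec]
    obtain ⟨h0, h1⟩ := ih
    obtain ⟨h2, h3⟩ := pow_add_two_sub_pow_le m i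
    refine ⟨by positivity, ?_⟩
    rcases Nat.lt_or_ge i 1 with hi | hi
    · -- `i = 0`
      have hi0 : i = 0 := by omega
      subst hi0
      norm_num
    · have hcast : ((i + 1 - 1 : ℕ) : ℝ) = i := by
        rw [Nat.add_sub_cancel]
      rw [hcast, show i + 1 - 2 = i - 1 by omega]
      have hi1 : ((i - 1 : ℕ) : ℝ) = (i : ℝ) - 1 := by
        rw [Nat.cast_sub hi]; push_cast; ring
      rw [hi1] at h1
      -- `(m+1)(m+2)^{i-2} ≤ (m+2)^{i-1}` (for `i ≥ 2`; for `i = 1` the coefficient vanishes)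
      have hA : ((m : ℝ) + 1) * ((i : ℝ) * ((i : ℝ) - 1) * ((m : ℝ) + 2) ^ (i - 2))
          ≤ (i : ℝ) * ((i : ℝ) - 1) * ((m : ℝ) + 2) ^ (i - 1) := by
        rcases Nat.lt_or_ge i 2 with hi2 | hi2
        · have : i = 1 := by omega
          subst this
          norm_num
        · have hp : ((m : ℝ) + 2) ^ (i - 1) = ((m : ℝ) + 2) * ((m : ℝ) + 2) ^ (i - 2) := by
            rw [show i - 1 = (i - 2) + 1 by omega, pow_succ, mul_comm]
          rw [hp]
          have hii : (0 : ℝ) ≤ (i : ℝ) * ((i : ℝ) - 1) := by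
            have : (2 : ℝ) ≤ i := by exact_mod_cast hi2
            nlinarith
          have hq : (0 : ℝ) ≤ ((m : ℝ) + 2) ^ (i - 2) := by positivity
          nlinarith [mul_nonneg hii hq]
      have hB : ((m : ℝ) + 1) * (((m : ℝ) + 2) ^ i - 2 * ((m : ℝ) + 1) ^ i + (m : ℝ) ^ i)
          ≤ ((m : ℝ) + 1) * ((i : ℝ) * ((i : ℝ) - 1) * ((m : ℝ) + 2) ^ (i - 2)) :=
        mul_le_mul_of_nonneg_left h1 (by positivity)
      push_cast
      nlinarith

/-- **Second differences of polynomial values**: `|g(m+2) − 2g(m+1) + g(m)| ≤ d(d−1)·‖g‖₁·(m+2)^{d−2}`.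
[folklore] -/
theorem abs_eval_second_diff_le (g : ℤ[X]) (m : ℕ) :
    |((g.eval ((m : ℤ) + 2) : ℤ) : ℝ) - 2 * ((g.eval ((m : ℤ) + 1) : ℤ) : ℝ) + ((g.eval (m : ℤ) : ℤ) : ℝ)|
      ≤ (g.natDegree : ℝ) * ((g.natDegree - 1 : ℕ) : ℝ) * coeffAbsSum g * ((m : ℝ) + 2) ^ (g.natDegree - 2) := by
  set d := g.natDegree with hd
  have hdiff : ((g.eval ((m : ℤ) + 2) : ℤ) : ℝ) - 2 * ((g.eval ((m : ℤ) + 1) : ℤ) : ℝ) + ((g.eval (m : ℤ) : ℤ) : ℝ)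
      = ∑ i ∈ range (d + 1),
          (g.coeff i : ℝ) * (((m : ℝ) + 2) ^ i - 2 * ((m : ℝ) + 1) ^ i + (m : ℝ) ^ i) := by
    rw [eval_eq_sum_range, eval_eq_sum_range, eval_eq_sum_range, ← hd]
    push_cast
    rw [mul_sum, ← sum_sub_distrib, ← sum_add_distrib]
    exact sum_congr rfl fun i _ => by ring
  rw [hdiff]
  refine (abs_sum_le_sum_abs _ _).trans ?_
  have hterm : ∀ i ∈ range (d + 1),
      |(g.coeff i : ℝ) * (((m : ℝ) + 2) ^ i - 2 * ((m : ℝ) + 1) ^ i + (m : ℝ) ^ i)|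
        ≤ (d : ℝ) * ((d - 1 : ℕ) : ℝ) * ((m : ℝ) + 2) ^ (d - 2) * |(g.coeff i : ℝ)| := by
    intro i hi
    rw [mem_range] at hi
    obtain ⟨h0, h1⟩ := pow_second_diff_le m i
    rw [abs_mul, abs_of_nonneg h0, mul_comm]
    refine mul_le_mul_of_nonneg_right (h1.trans ?_) (abs_nonneg _)
    refine mul_le_mul ?_ (pow_le_pow_right₀ (by linarith [(Nat.cast_nonneg m : (0 : ℝ) ≤ m)]) (by omega))
      (by positivity) (by positivity)
    exact mul_le_mul (by exact_mod_cast (by omega : i ≤ d)) (by exact_mod_cast (by omega : i - 1 ≤ d - 1))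
      (Nat.cast_nonneg _) (Nat.cast_nonneg _)
  refine (sum_le_sum hterm).trans (le_of_eq ?_)
  rw [← mul_sum, coeffAbsSum, ← hd]
  ring

end Summit.Parity.BatemanHorn.Theorems
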